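import Mathlib
import HarnessLib
import Literature.AlgebraicGeometry.HodgeTheory.SemiregularityHigherSigma
import Literature.AlgebraicGeometry.HodgeTheory.SemiregularityMapDinatural

/-!
# Centrality of `End(E)` on `Ext²(E, E)`, retracts, classes through an auxiliary bundle, and the shape of Markman's
# criterion — necessary conditions for `IsISemiregular` (route `KleimanBFSeeds`, crux K2ᵀ 28148, typed obstructions)

HONEST FRAMING: HELPER ∕ obstruction lemmas `--supports stmt-HodgeConjecture-28148` (crux
`TwistNormalisedKleimanSemiregularAnchor`, registered rung `stub_rung_CMclass_d3 : KleimanAnchorRungCM 3` of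
`Cruxes/TwistNormalisedKleimanSemiregularAnchor/Lines/chosen_anchor.lean`). Nothing here constructs a sheaf or proves the
rung, K2ᵀ, `WeilSixfolds`, HC_AV, HC_CM or HC. Every statement is a CONSEQUENCE of the tree's dinaturality theorem
`sigmaHigher_dinatural` ([BuchweitzFlenner2003] Cor. 4.8 in degree `(0,2)`, `HodgeTheory/SemiregularityMapDinatural`) for the
tree's REAL carriers `sigmaHigher hE q : Ext²(E,E) →+ H^{q+2}(X, Ω^q)` and `IsISemiregular hE I`
(`HodgeTheory/SemiregularityHigherSigma`), on an arbitrary `S`-scheme `X` and finite locally free `𝒪_X`-modules.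

WHAT IS HERE (all proved; no `def`, no named fact, no instance).
* §1 CENTRALITY. If `E` is `I`-semiregular (any `I`) then `End(E) = Ext⁰(E,E)` acts CENTRALLY on `Ext²(E,E)`:
  `g · y = y · g` for every `g : E ⟶ E`, `y ∈ Ext²(E,E)` (`IsISemiregular.mk₀_comp_eq_comp_mk₀`; Cor. 4.8 says
  `σ_q(g·y − y·g) = 0`, and `σ_I` is injective). Consequences: for an idempotent `e` (`e ≫ e = e`) the off-diagonal
  blocks `e · y · (𝟙 − e)` and `(𝟙 − e) · y · e` VANISH (`…_idem_offDiag_eq_zero`, `…_offDiag_idem_eq_zero`) — the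
  retract form of the tree's `IsISemiregular.eq_zero_of_biprod₁₂` (no chosen biproduct needed); for `i ≫ p = 0` the class
  `p · y · i` vanishes (`IsISemiregular.comp_eq_zero_of_comp_eq_zero`); for a square-zero `f` (`f ≫ f = 0`),
  `f · y · f = 0` (`IsISemiregular.sqZero_sandwich_eq_zero`).
* §2 RETRACTS. A retract `E′` of an `I`-semiregular `E` (`ι ≫ π = 𝟙 E′`) is `I`-semiregular
  (`IsISemiregular.of_retract`), generalising the tree's `IsISemiregular.biprod_fst ∕ _snd`.
* §3 CLASSES THROUGH AN AUXILIARY BUNDLE `F` (the general form of THEOREM Σ of the crux workfile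
  `SIGMA-INVISIBLE-N8-rung1-g2.md`, whose `F = 𝒪_X` and Atiyah-flat cases are `Negative/SigmaInvisibleUnit.lean`): for
  `u : E ⟶ F`, `B ∈ Ext²(F,E)` the class `u · B ∈ Ext²(E,E)` is seen by `σ^E_q` exactly as `σ^F_q` sees `B · u ∈ Ext²(F,F)`;
  hence an `I`-semiregular `E` has `u · B = 0` as soon as `σ^F_q(B · u) = 0` for `q ∈ I`
  (`IsISemiregular.mk₀_comp_eq_zero_of_sigmaHigher_factor`), and symmetrically for `B′ · u′`
  (`IsISemiregular.comp_mk₀_eq_zero_of_sigmaHigher_factor`); in particular through any `F` whose `σ^F_q` vanish for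
  `q ∈ I` (`…_of_sigmaHigher_factor_eq_zero`).
* §4 THE SHAPE OF MARKMAN'S CRITERION [Markman2025SurveySecant, Lemma 11.3] («if the kernel of
  `ev_E : HH²(Y) → Hom(E,E[2])` is equal to the annihilator of `ch(E)` in `HH²(Y)` and `ev_E` is surjective, then `E` is
  semi-regular»): for ANY map `ev : M → Ext²(E,E)` and ANY family `c_q : M → H^{q+2}(Ω^q)` with `σ_q ∘ ev = c_q`
  (`q ∈ I`), surjectivity of `ev` plus `ker c_I ⊆ ker ev` gives `IsISemiregular hE I`
  (`isISemiregular_of_surjective_factorisation`); conversely for an `I`-semiregular `E` the kernel condition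
  `ker ev = ker c_I` is AUTOMATIC (`IsISemiregular.factorisation_ker_iff`). The tree has no Hochschild cohomology, so
  `M`, `ev`, `c` are abstract binders: this records the logical skeleton of the instrument column «rank `ev_E`» of the
  rung's docstring, not Lemma 11.3 itself.

USE (pen side, crux workfiles of rung-1 g0–g4): §1–§3 are the σ-free pre-filters «no idempotent ∕ square-zero sandwich
classes, no off-diagonal classes, no classes through σ-dead bundles» that every written object of the line must pass
before a σ-row is computed; §4 is the positive door used by Markman for secant sheaves (split cells).

References: [BuchweitzFlenner2003] R.-O. Buchweitz, H. Flenner, A semiregularity map for modules and applications to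
deformations, Compositio Math. 137 (2003), §4 Cor. 4.8, §5; [Markman2025SurveySecant] E. Markman, Secant sheaves and
Weil classes on abelian varieties, arXiv:2509.23403, §11.4 Lemma 11.3. Tree: `SemiregularityHigherSigma`,
`SemiregularityMapDinatural`, `Negative/SigmaInvisibleUnit.lean`, `Negative/SplitPureWeilSeeds.lean`.
-/

-- every declaration of this problem lives in `Summit.HodgeConjecture.HodgeConjecture.…` (summit = sub-problem)
set_option linter.dupNamespace false

noncomputable section

open CategoryTheory CategoryTheory.Abelian AlgebraicGeometry Opposite TopologicalSpace Limits

namespace Summit.HodgeConjecture.HodgeConjecture.Theorems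

open Literature.AlgebraicGeometry.Modules Literature.AlgebraicGeometry.Motives
open Literature.AlgebraicGeometry.HodgeTheory

universe u

variable {S : Type u} [CommRing S] {X : Over (Spec (CommRingCat.of S))}

/-! ### §1 Centrality of `End(E)` on `Ext²(E,E)` for an `I`-semiregular `E` -/

/-- **Centrality.** If `E` is `I`-semiregular then every endomorphism `g : E ⟶ E` commutes with every
`y ∈ Ext²(E, E)`: `g · y = y · g` ([BF03] Cor. 4.8: `σ_q(g·y − y·g) = 0` for all `q`; `σ_I` is injective).
[cite: BuchweitzFlenner2003, Cor. 4.8 and §5 (I-semiregular)] -/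
theorem IsISemiregular.mk₀_comp_eq_comp_mk₀ {E : X.left.Modules} {hE : IsFiniteLocallyFree E} {I : Set ℕ}
    (h : IsISemiregular hE I) (g : E ⟶ E) (y : Ext E E 2) :
    (Ext.mk₀ g).comp y (zero_add 2) = y.comp (Ext.mk₀ g) (add_zero 2) :=
  sub_eq_zero.mp (h _ fun q _ => sigmaHigher_commutator_eq_zero hE g q y)

/-- **Off-diagonal classes vanish** (`i ≫ p = 0` form): if `E` is `I`-semiregular, `i : E₂ ⟶ E`, `p : E ⟶ E₁` with
`i ≫ p = 0` and `E₂` finite locally free, then `p · y · i = 0` in `Ext²(E,E)` for every `y ∈ Ext²(E₁, E₂)`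
(the tree's `sigmaHigher_eq_zero_of_comp_eq_zero` puts it in `⋂_q ker σ_q`).
[cite: BuchweitzFlenner2003, Cor. 4.8 (consequence) and §5] -/
theorem IsISemiregular.comp_eq_zero_of_comp_eq_zero {E E₁ E₂ : X.left.Modules} {hE : IsFiniteLocallyFree E}
    {I : Set ℕ} (h : IsISemiregular hE I) (hE₂ : IsFiniteLocallyFree E₂) (p : E ⟶ E₁) (i : E₂ ⟶ E)
    (hip : i ≫ p = 0) (y : Ext E₁ E₂ 2) :
    (Ext.mk₀ p).comp (y.comp (Ext.mk₀ i) (add_zero 2)) (zero_add 2) = 0 :=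
  h _ fun q _ => sigmaHigher_eq_zero_of_comp_eq_zero hE hE₂ p i hip q y

/-- **Idempotents: the block `e · y · (𝟙 − e)` vanishes.** For an `I`-semiregular `E`, an idempotent `e : E ⟶ E`
(`e ≫ e = e`) and any `y ∈ Ext²(E,E)`: `e · (y · (𝟙 − e)) = 0` — by centrality this class equals
`(y · (𝟙 − e)) · e = y · ((𝟙 − e) ≫ e) = 0`. Retract form of `IsISemiregular.eq_zero_of_biprod₁₂` (no chosen biproduct).
[cite: BuchweitzFlenner2003, Cor. 4.8 (consequence) and §5] -/
theorem IsISemiregular.idem_offDiag_eq_zero {E : X.left.Modules} {hE : IsFiniteLocallyFree E} {I : Set ℕ}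
    (h : IsISemiregular hE I) (e : E ⟶ E) (he : e ≫ e = e) (y : Ext E E 2) :
    (Ext.mk₀ e).comp (y.comp (Ext.mk₀ (𝟙 E - e)) (add_zero 2)) (zero_add 2) = 0 := by
  rw [IsISemiregular.mk₀_comp_eq_comp_mk₀ h e, Ext.comp_assoc_of_third_deg_zero, Ext.mk₀_comp_mk₀, Preadditive.sub_comp,
    Category.id_comp, he, sub_self, Ext.mk₀_zero, Ext.comp_zero]

/-- **Idempotents: the block `(𝟙 − e) · y · e` vanishes** likewise. [cite: BuchweitzFlenner2003, Cor. 4.8 (consequence) and §5] -/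
theorem IsISemiregular.offDiag_idem_eq_zero {E : X.left.Modules} {hE : IsFiniteLocallyFree E} {I : Set ℕ}
    (h : IsISemiregular hE I) (e : E ⟶ E) (he : e ≫ e = e) (y : Ext E E 2) :
    (Ext.mk₀ (𝟙 E - e)).comp (y.comp (Ext.mk₀ e) (add_zero 2)) (zero_add 2) = 0 := by
  rw [IsISemiregular.mk₀_comp_eq_comp_mk₀ h (𝟙 E - e), Ext.comp_assoc_of_third_deg_zero, Ext.mk₀_comp_mk₀, Preadditive.comp_sub,
    Category.comp_id, he, sub_self, Ext.mk₀_zero, Ext.comp_zero]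

/-- **Square-zero sandwiches vanish.** For an `I`-semiregular `E`, `f : E ⟶ E` with `f ≫ f = 0` and any
`y ∈ Ext²(E,E)`: `f · (y · f) = 0` (centrality: `= (y · f) · f = y · (f ≫ f) = 0`). In a display with nilpotent
endomorphisms (the radical of `End E`) this kills every class routed twice through the same square-zero map.
[cite: BuchweitzFlenner2003, Cor. 4.8 (consequence) and §5] -/
theorem IsISemiregular.sqZero_sandwich_eq_zero {E : X.left.Modules} {hE : IsFiniteLocallyFree E} {I : Set ℕ}
    (h : IsISemiregular hE I) (f : E ⟶ E) (hf : f ≫ f = 0) (y : Ext E E 2) :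
    (Ext.mk₀ f).comp (y.comp (Ext.mk₀ f) (add_zero 2)) (zero_add 2) = 0 := by
  rw [IsISemiregular.mk₀_comp_eq_comp_mk₀ h f, Ext.comp_assoc_of_third_deg_zero, Ext.mk₀_comp_mk₀, hf, Ext.mk₀_zero, Ext.comp_zero]

/-! ### §2 Retracts of `I`-semiregular bundles -/

/-- **`σ_q` of a retract is read off the ambient bundle**: for `ι : E′ ⟶ E`, `π : E ⟶ E′` with `ι ≫ π = 𝟙 E′`
(`E`, `E′` finite locally free) and `y ∈ Ext²(E′, E′)`, `σ_q^{E}(π · y · ι) = σ_q^{E′}(y)` (dinaturality along `π`).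
[cite: BuchweitzFlenner2003, Cor. 4.8 (consequence)] -/
theorem sigmaHigher_retract {E E' : X.left.Modules} (hE : IsFiniteLocallyFree E) (hE' : IsFiniteLocallyFree E')
    (ι : E' ⟶ E) (π : E ⟶ E') (hιπ : ι ≫ π = 𝟙 E') (q : ℕ) (y : Ext E' E' 2) :
    sigmaHigher hE q ((Ext.mk₀ π).comp (y.comp (Ext.mk₀ ι) (add_zero 2)) (zero_add 2)) = sigmaHigher hE' q y := by
  rw [sigmaHigher_dinatural hE hE' π q, Ext.comp_assoc_of_third_deg_zero, Ext.mk₀_comp_mk₀, hιπ, Ext.comp_mk₀_id]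

/-- **A retract of an `I`-semiregular bundle is `I`-semiregular**: if `ι ≫ π = 𝟙 E′` and `E` is `I`-semiregular then so
is `E′` (`y = ι · (π · y · ι) · π`, and `π · y · ι ∈ ⋂_{q ∈ I} ker σ^E_q` when `y ∈ ⋂_{q∈I} ker σ^{E′}_q`). Generalises the
tree's `IsISemiregular.biprod_fst ∕ _snd`. [cite: BuchweitzFlenner2003, Cor. 4.8 (consequence) and §5 (I-semiregular)] -/
theorem IsISemiregular.of_retract {E E' : X.left.Modules} {hE : IsFiniteLocallyFree E} {I : Set ℕ}
    (h : IsISemiregular hE I) (hE' : IsFiniteLocallyFree E') (ι : E' ⟶ E) (π : E ⟶ E') (hιπ : ι ≫ π = 𝟙 E') :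
    IsISemiregular hE' I := by
  intro y hy
  have hx : (Ext.mk₀ π).comp (y.comp (Ext.mk₀ ι) (add_zero 2)) (zero_add 2) = 0 :=
    h _ fun q hq => (sigmaHigher_retract hE hE' ι π hιπ q y).trans (hy q hq)
  have key : y = (Ext.mk₀ ι).comp
      (((Ext.mk₀ π).comp (y.comp (Ext.mk₀ ι) (add_zero 2)) (zero_add 2)).comp (Ext.mk₀ π) (add_zero 2))
      (zero_add 2) := by
    rw [Ext.comp_assoc_of_third_deg_zero, Ext.mk₀_comp_mk₀_assoc, hιπ, Ext.mk₀_id_comp,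
      Ext.comp_assoc_of_third_deg_zero, Ext.mk₀_comp_mk₀, hιπ, Ext.comp_mk₀_id]
  calc y = _ := key
    _ = 0 := by rw [hx, Ext.zero_comp, Ext.comp_zero]

/-! ### §3 Classes of `Ext²(E,E)` through an auxiliary bundle `F` (THEOREM Σ, general form) -/

/-- **THEOREM Σ, general form, first shape.** For `E`, `F` finite locally free, `u : E ⟶ F`, `B ∈ Ext²(F, E)`: if
`σ^F_q(B · u) = 0` for all `q ∈ I` (a statement about `Ext²(F,F)`, e.g. automatic for `q ≥ 1` when `F` is Atiyah-flat —
`Negative/SigmaInvisibleUnit.lean`) and `E` is `I`-semiregular, then `u · B = 0` in `Ext²(E,E)`.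
[cite: BuchweitzFlenner2003, Cor. 4.8 (consequence) and §5 (I-semiregular)] -/
theorem IsISemiregular.mk₀_comp_eq_zero_of_sigmaHigher_factor {E F : X.left.Modules} {hE : IsFiniteLocallyFree E}
    {I : Set ℕ} (h : IsISemiregular hE I) (hF : IsFiniteLocallyFree F) (u : E ⟶ F) (B : Ext F E 2)
    (hB : ∀ q ∈ I, sigmaHigher hF q (B.comp (Ext.mk₀ u) (add_zero 2)) = 0) :
    (Ext.mk₀ u).comp B (zero_add 2) = 0 :=
  h _ fun q hq => (sigmaHigher_dinatural hE hF u q B).trans (hB q hq)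

/-- **THEOREM Σ, general form, second shape.** For `u′ : F ⟶ E`, `B′ ∈ Ext²(E, F)`: if `σ^F_q(u′ · B′) = 0` for all
`q ∈ I` and `E` is `I`-semiregular, then `B′ · u′ = 0` in `Ext²(E,E)`.
[cite: BuchweitzFlenner2003, Cor. 4.8 (consequence) and §5 (I-semiregular)] -/
theorem IsISemiregular.comp_mk₀_eq_zero_of_sigmaHigher_factor {E F : X.left.Modules} {hE : IsFiniteLocallyFree E}
    {I : Set ℕ} (h : IsISemiregular hE I) (hF : IsFiniteLocallyFree F) (u' : F ⟶ E) (B' : Ext E F 2)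
    (hB' : ∀ q ∈ I, sigmaHigher hF q ((Ext.mk₀ u').comp B' (zero_add 2)) = 0) :
    B'.comp (Ext.mk₀ u') (add_zero 2) = 0 :=
  h _ fun q hq => (sigmaHigher_dinatural hF hE u' q B').symm.trans (hB' q hq)

/-- **Through a `σ_I`-dead bundle nothing survives**: if `σ^F_q = 0` for every `q ∈ I` (e.g. `F` Atiyah-flat and
`0 ∉ I`) then for an `I`-semiregular `E` every class `u · B : E → F → E[2]` vanishes.
[cite: BuchweitzFlenner2003, Cor. 4.8 (consequence) and §5 (I-semiregular)] -/
theorem IsISemiregular.mk₀_comp_eq_zero_of_sigmaHigher_factor_eq_zero {E F : X.left.Modules}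
    {hE : IsFiniteLocallyFree E} {I : Set ℕ} (h : IsISemiregular hE I) (hF : IsFiniteLocallyFree F)
    (hF0 : ∀ q ∈ I, sigmaHigher hF q = 0) (u : E ⟶ F) (B : Ext F E 2) :
    (Ext.mk₀ u).comp B (zero_add 2) = 0 :=
  IsISemiregular.mk₀_comp_eq_zero_of_sigmaHigher_factor h hF u B fun q hq => by
    rw [hF0 q hq, AddMonoidHom.zero_apply]

/-- The same for classes `B′ · u′ : E → F[2] → E[2]`. [cite: BuchweitzFlenner2003, Cor. 4.8 (consequence) and §5] -/
theorem IsISemiregular.comp_mk₀_eq_zero_of_sigmaHigher_factor_eq_zero {E F : X.left.Modules}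
    {hE : IsFiniteLocallyFree E} {I : Set ℕ} (h : IsISemiregular hE I) (hF : IsFiniteLocallyFree F)
    (hF0 : ∀ q ∈ I, sigmaHigher hF q = 0) (u' : F ⟶ E) (B' : Ext E F 2) :
    B'.comp (Ext.mk₀ u') (add_zero 2) = 0 :=
  IsISemiregular.comp_mk₀_eq_zero_of_sigmaHigher_factor h hF u' B' fun q hq => by
    rw [hF0 q hq, AddMonoidHom.zero_apply]

/-- **Rank form of §3 on the `F`-side**: the map `Φ_u : Ext²(F,E) → Ext²(E,E)`, `B ↦ u · B`, is INJECTIVE on no more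
than what `σ^F_I` sees — precisely, for an `I`-semiregular `E`, `u · B₁ = u · B₂` whenever `σ^F_q(B₁ · u) = σ^F_q(B₂ · u)`
for all `q ∈ I`. (Pen corollary: `rank Φ_u ≤ rank σ^F_I`, e.g. `≤ h^{0,2}` for a line bundle `F`.)
[cite: BuchweitzFlenner2003, Cor. 4.8 (consequence) and §5 (I-semiregular)] -/
theorem IsISemiregular.mk₀_comp_eq_of_sigmaHigher_factor_eq {E F : X.left.Modules} {hE : IsFiniteLocallyFree E}
    {I : Set ℕ} (h : IsISemiregular hE I) (hF : IsFiniteLocallyFree F) (u : E ⟶ F) (B₁ B₂ : Ext F E 2)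
    (hB : ∀ q ∈ I, sigmaHigher hF q (B₁.comp (Ext.mk₀ u) (add_zero 2)) =
      sigmaHigher hF q (B₂.comp (Ext.mk₀ u) (add_zero 2))) :
    (Ext.mk₀ u).comp B₁ (zero_add 2) = (Ext.mk₀ u).comp B₂ (zero_add 2) := by
  have h₁ : (Ext.mk₀ u).comp (B₁ - B₂) (zero_add 2) =
      (Ext.mk₀ u).comp B₁ (zero_add 2) - (Ext.mk₀ u).comp B₂ (zero_add 2) := by
    rw [sub_eq_add_neg, Ext.comp_add, Ext.comp_neg, ← sub_eq_add_neg]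
  have h₂ : (B₁ - B₂).comp (Ext.mk₀ u) (add_zero 2) =
      B₁.comp (Ext.mk₀ u) (add_zero 2) - B₂.comp (Ext.mk₀ u) (add_zero 2) := by
    rw [sub_eq_add_neg, Ext.add_comp, Ext.neg_comp, ← sub_eq_add_neg]
  rw [← sub_eq_zero, ← h₁]
  refine IsISemiregular.mk₀_comp_eq_zero_of_sigmaHigher_factor h hF u (B₁ - B₂) fun q hq => ?_
  rw [h₂, map_sub, sub_eq_zero]
  exact hB q hq

/-! ### §4 The logical shape of Markman's sufficient criterion (Lemma 11.3) and its necessity -/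

/-- **Markman's criterion, abstract form.** Let `ev : M → Ext²(E,E)` be ANY surjective map (in print: evaluation
`HH²(Y) → Hom(E, E[2])` of Hochschild classes) and `c_q : M → H^{q+2}(X, Ω^q)` maps with `σ_q(ev m) = c_q m` for `q ∈ I`
(in print: `c = (⌟ ch(E)) ∘ HKR`). If `ker c_I ⊆ ker ev` — every `m` killed by all `c_q`, `q ∈ I`, has `ev m = 0` — then
`E` is `I`-semiregular. («If the kernel of `ev_E` is equal to the annihilator of `ch(E)` in `HH²(Y)` and `ev_E` is
surjective, then `E` is semi-regular.») The tree has no Hochschild cohomology: `M`, `ev`, `c` are binders, and this is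
only the diagram chase of the printed proof. [cite: Markman2025SurveySecant, Lemma 11.3] -/
theorem isISemiregular_of_surjective_factorisation {E : X.left.Modules} (hE : IsFiniteLocallyFree E) (I : Set ℕ)
    {M : Type*} (ev : M → Ext E E 2) (hev : Function.Surjective ev)
    (c : (q : ℕ) → M → hodgeCohomology X q (q + 2)) (hc : ∀ q ∈ I, ∀ m, sigmaHigher hE q (ev m) = c q m)
    (hker : ∀ m, (∀ q ∈ I, c q m = 0) → ev m = 0) : IsISemiregular hE I := by
  intro x hx
  obtain ⟨m, rfl⟩ := hev x
  exact hker m fun q hq => (hc q hq m).symm.trans (hx q hq)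

/-- **Necessity of the kernel condition.** Conversely, for an `I`-semiregular `E` and any factorisation
`σ_q ∘ ev = c_q` (`q ∈ I`) as above, `ev m = 0 ↔ (∀ q ∈ I, c_q m = 0)`: the kernel of `ev` IS the joint kernel of the
`c_q` (Markman's first hypothesis is forced; only the surjectivity of `ev` is extra). [cite: Markman2025SurveySecant, Lemma 11.3] -/
theorem IsISemiregular.factorisation_ker_iff {E : X.left.Modules} {hE : IsFiniteLocallyFree E} {I : Set ℕ}
    (h : IsISemiregular hE I) {M : Type*} (ev : M → Ext E E 2)
    (c : (q : ℕ) → M → hodgeCohomology X q (q + 2)) (hc : ∀ q ∈ I, ∀ m, sigmaHigher hE q (ev m) = c q m) (m : M) :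
    ev m = 0 ↔ ∀ q ∈ I, c q m = 0 := by
  constructor
  · intro hm q hq
    rw [← hc q hq m, hm, map_zero]
  · intro hm
    exact h _ fun q hq => (hc q hq m).trans (hm q hq)

end Summit.HodgeConjecture.HodgeConjecture.Theorems

end
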